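/-
Copyright (c) 2026. All rights reserved.
Released under Apache 2.0 license as described in the file LICENSE.
-/
import Literature.Probability.LatticeModels.GoodAboveFromPinning
import Literature.Probability.LatticeModels.GoodCrossingCaseI
import Literature.Probability.LatticeModels.LevelTransport
import Literature.Probability.LatticeModels.OrientationReflect
import HarnessLib

/-!
# The two layers touch above every height with probability `≥ c₀` (GH2000, §5, Case 3)

Georgii–Higuchi, J. Math. Phys. 41 (2000), proof of Lemma 5.5, Case 3, uses Lemma 5.4 ("`γ_up(ω)`
and `γ_up(ω̂)` intersect each other infinitely often") to join the two pinned paths. The present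
formalisation (`GoodAboveFromPinning`) needs only **one touching of the infinite `+∗`structure of
the second layer with the infinite `-`structure of the first layer at height `≥ n`**, the event
`TouchAt n`, with a probability bounded below uniformly in `n`. This file derives such a bound from
the tree's comparison of the last axis sites of the two layers (`MaxAxisComparison`,
`InterfaceTouching`, `LastAxisSite` — the statistic `a_n` of the proof of Lemma 5.4):

* `le_measure_touchAt_zero` — at level `0`, in the orientation "`+`face on the left" (the infinite
  `+∗`cluster of `π_up` touches the axis outside every box on the left, an infinite `-`cluster of
  `π_up` exists): `c₀ ≤ ν(TouchAt 0)`, `c₀ = (1 - (1 + e^{-8|β|}/2)⁻¹)/2`, `ν = μ ⊗ (μ ∘ θ_{s e₁}⁻¹)`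
  (`le_measure_axisReach_shift` and the touching criterion `touch_of_le_maxAxis`);
* `le_measure_touchAt_zero_right` — the same in the orientation "`+`face on the right" (reflection
  `x₁ ↦ -x₁`, as in `OrientationReflect`);
* `touchAt_configShift_iff`, `le_measure_touchAt_of_level`, `le_measure_touchAt_of_level_right` —
  at level `n`: the same bound for `ν(TouchAt n)` from the hypotheses for the vertically shifted
  measure `μ ∘ T⁻¹`, `(T ω)(x) = ω(x + n e₂)` (Georgii–Higuchi's half-planes `π_{n,up}`).

## References

* H.-O. Georgii, Y. Higuchi, J. Math. Phys. 41 (2000) 1153–1169, proofs of Lemma 5.4 (p. 14) and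
  Lemma 5.5, Case 3 (p. 15) [GeorgiiHiguchi2000].
-/

namespace Literature.Probability.LatticeModels

open MeasureTheory SimpleGraph Percolation Filter
open scoped ENNReal

noncomputable section

variable {β : ℝ} {μ : Measure (SpinConfig (Site 2))}

/-! ### Level `0`, `+`face on the left -/

section Zero

/-- **The layers touch with probability `≥ c₀`** (level `0`, `+`face on the left): for
`β > β_c(2)` and `μ ∈ 𝒢(β, 0)` under which the infinite `+∗`cluster of `π_up` touches the axis
outside every box on the left and an infinite `-`cluster of `π_up` exists,
`c₀ ≤ (μ ⊗ μ ∘ θ_{s e₁}⁻¹)(TouchAt 0)`. [cite: GeorgiiHiguchi2000, Lemma 5.4 and Lemma 5.5 (proof, Case 3)] -/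
theorem le_measure_touchAt_zero (hβc : criticalBeta 2 < β) (hμ : μ ∈ isingGibbsMeasures 2 β 0) (s : ℤˣ)
    (hL : ∀ᵐ ω ∂μ, ∃ x, ∀ n : ℕ, ∃ k : ℤ, k < -(n : ℤ) ∧
      (![k, 0] : Site 2) ∈ siteCluster zdStarGraph (spinSites 1 ω ∩ halfPlane 0) x)
    (hC : ∀ᵐ ω ∂μ, ∃ y, (siteCluster (zdGraph 2) (spinSites (-1) ω ∩ halfPlane 0) y).Infinite) :
    (1 - (1 + ENNReal.ofReal (Real.exp (-(8 * |β|)) / 2))⁻¹) / 2 ≤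
      (μ.prod (μ.map (configShift (Pi.single 0 (s : ℤ))))) {p | TouchAt 0 p} := by
  classical
  have hμG : IsGibbsMeasure (isingSpecification (zdGraph 2) β 0) μ := hμ
  haveI := hμG.isProbabilityMeasure
  set μ' : Measure (SpinConfig (Site 2)) := μ.map (configShift (Pi.single 0 (s : ℤ))) with hμ'
  have hμ'G : μ' ∈ isingGibbsMeasures 2 β 0 := mem_isingGibbsMeasures_map_configShift hμ _
  have hμ'GG : IsGibbsMeasure (isingSpecification (zdGraph 2) β 0) μ' := hμ'G
  haveI : IsProbabilityMeasure μ' := hμ'GG.isProbabilityMeasure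
  set R : ℤ → Set (SpinConfig (Site 2)) := fun j =>
    {ω : SpinConfig (Site 2) | ∃ k : ℤ, j ≤ k ∧ (siteCluster zdStarGraph (spinSites 1 ω ∩ halfPlane 0) ![k, 0]).Infinite} with hR
  set Cmp := {p : SpinConfig (Site 2) × SpinConfig (Site 2) | ∃ j : ℤ, p.1 ∉ R (j + 1) ∧ p.2 ∈ R j} with hCmp
  have hexists : ∀ᵐ ω ∂μ, ∃ j : ℤ, ω ∈ R j \ R (j + 1) := by
    filter_upwards [ae_exists_lastAxisSite hβc hμ, hL, hC] with ω h hLω hCω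
    exact h hLω hCω
  have h1 : (1 - (1 + ENNReal.ofReal (Real.exp (-(8 * |β|)) / 2))⁻¹) / 2 ≤ (μ.prod μ') Cmp :=
    le_measure_axisReach_shift hμ hexists s
  -- the almost sure facts of the first layer
  have key1 : ∀ᵐ ω ∂μ, ((∃ j : ℤ, ω ∈ R j \ R (j + 1)) ∧
      (∃ yC, (siteCluster (zdGraph 2) (spinSites (-1) ω ∩ halfPlane 0) yC).Infinite) ∧
      (∃ x₀, ∀ n : ℕ, ∃ k : ℤ, k < -(n : ℤ) ∧ (![k, 0] : Site 2) ∈ siteCluster zdStarGraph (spinSites 1 ω ∩ halfPlane 0) x₀)) ∧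
      (∀ x₁ x₂ y₀, (siteCluster zdStarGraph (spinSites 1 ω ∩ halfPlane 0) x₁).Infinite →
          (siteCluster zdStarGraph (spinSites 1 ω ∩ halfPlane 0) x₂).Infinite →
          (siteCluster (zdGraph 2) (spinSites (-1) ω ∩ halfPlane 0) y₀).Infinite →
          siteCluster zdStarGraph (spinSites 1 ω ∩ halfPlane 0) x₁ = siteCluster zdStarGraph (spinSites 1 ω ∩ halfPlane 0) x₂) ∧
      (∀ x₀ y₀, (siteCluster zdStarGraph (spinSites 1 ω ∩ halfPlane 0) x₀).Infinite →
          (siteCluster (zdGraph 2) (spinSites (-1) ω ∩ halfPlane 0) y₀).Infinite →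
          (∀ a k : ℤ, (![a, 0] : Site 2) ∈ siteCluster zdStarGraph (spinSites 1 ω ∩ halfPlane 0) x₀ →
              (![k, 0] : Site 2) ∈ siteCluster (zdGraph 2) (spinSites (-1) ω ∩ halfPlane 0) y₀ → a < k) ∨
            (∀ a k : ℤ, (![a, 0] : Site 2) ∈ siteCluster zdStarGraph (spinSites 1 ω ∩ halfPlane 0) x₀ →
              (![k, 0] : Site 2) ∈ siteCluster (zdGraph 2) (spinSites (-1) ω ∩ halfPlane 0) y₀ → k < a)) ∧
      (∀ y₀, (siteCluster (zdGraph 2) (spinSites (-1) ω ∩ halfPlane 0) y₀).Infinite →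
          ∀ n : ℕ, ∃ z ∈ siteCluster (zdGraph 2) (spinSites (-1) ω ∩ halfPlane 0) y₀, z 1 = 0 ∧ (n : ℤ) < |z 0|) := by
    filter_upwards [hexists, hC, hL, ae_plusStar_cluster_unique hβc hμ, ae_plusStar_minus_sides hβc hμ,
      ae_minus_touches_axis_io (G := zdGraph 2) hβc le_rfl zdGraph_le_zdStarGraph hμ] with ω h1 h2 h3 h5 h6 h7
    exact ⟨⟨h1, h2, h3⟩, h5, h6, h7⟩
  have hae1 := (Measure.quasiMeasurePreserving_fst (μ := μ) (ν := μ')).ae key1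
  have hincl : ∀ᵐ p ∂(μ.prod μ'), p ∈ Cmp → p ∈ {p : SpinConfig (Site 2) × SpinConfig (Site 2) | TouchAt 0 p} := by
    filter_upwards [hae1] with p h1 hp
    obtain ⟨⟨⟨j₀, hj₀, hj₀'⟩, ⟨yC, hyC⟩, ⟨x₀, hLω⟩⟩, huniqD, hsides, htouchC⟩ := h1
    obtain ⟨j, hp1, hp2⟩ := hp
    set ω := p.1 with hω
    set ω' := p.2 with hω'
    -- the last axis site `a` of the first layer
    obtain ⟨a, hja, hDinf⟩ := hj₀
    have hamax : ∀ k : ℤ, (siteCluster zdStarGraph (spinSites 1 ω ∩ halfPlane 0) ![k, 0]).Infinite → k ≤ a := by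
      intro k hk
      by_contra hlt
      exact hj₀' ⟨k, by omega, hk⟩
    have haD : (![a, 0] : Site 2) ∈ siteCluster zdStarGraph (spinSites 1 ω ∩ halfPlane 0) ![a, 0] :=
      (mem_siteCluster_self_iff _ _ _).2 hDinf.nonempty.some_mem.1
    have hmax : ∀ k : ℤ, (![k, 0] : Site 2) ∈ siteCluster zdStarGraph (spinSites 1 ω ∩ halfPlane 0) ![a, 0] → k ≤ a := by
      intro k hk
      refine hamax k ?_
      rw [siteCluster_eq_of_mem ((mem_siteCluster_self_iff _ _ _).2 hk.2.1) hk]; exact hDinf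
    have hx₀inf := infinite_of_axis_unbounded_below hLω
    have hDx₀ : siteCluster zdStarGraph (spinSites 1 ω ∩ halfPlane 0) x₀ = siteCluster zdStarGraph (spinSites 1 ω ∩ halfPlane 0) ![a, 0] :=
      huniqD x₀ _ yC hx₀inf hDinf hyC
    have hside : ∀ y₀, (siteCluster (zdGraph 2) (spinSites (-1) ω ∩ halfPlane 0) y₀).Infinite →
        ∀ b k : ℤ, (![b, 0] : Site 2) ∈ siteCluster zdStarGraph (spinSites 1 ω ∩ halfPlane 0) ![a, 0] →
          (![k, 0] : Site 2) ∈ siteCluster (zdGraph 2) (spinSites (-1) ω ∩ halfPlane 0) y₀ → b < k := by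
      intro y₀ hy₀
      rcases hsides (![a, 0]) y₀ hDinf hy₀ with h | h
      · exact h
      · exfalso
        obtain ⟨zk, hzk, hzk1, -⟩ := htouchC y₀ hy₀ 0
        have hk : (![zk 0, 0] : Site 2) ∈ siteCluster (zdGraph 2) (spinSites (-1) ω ∩ halfPlane 0) y₀ := by
          rw [← eq_axis_of_apply_one hzk1]; exact hzk
        obtain ⟨b, hb, hbD⟩ := hLω (zk 0).natAbs
        rw [hDx₀] at hbD
        have := h b (zk 0) hbD hk
        omega
    -- the second layer's cluster through `(k', 0)`, `k' ≥ j ≥ a`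
    obtain ⟨k', hjk', hinf'⟩ := hp2
    have hak' : a ≤ k' := by
      have : ¬ (j + 1 ≤ a) := fun h => hp1 ⟨a, h, hDinf⟩
      omega
    have ha'D' : (![k', 0] : Site 2) ∈ siteCluster zdStarGraph (spinSites 1 ω' ∩ halfPlane 0) ![k', 0] :=
      (mem_siteCluster_self_iff _ _ _).2 hinf'.nonempty.some_mem.1
    obtain ⟨z, hz, z', hz', hzz'⟩ := touch_of_le_maxAxis hDinf haD hmax hside htouchC hinf' ha'D' hak'
    have hCinf : (siteCluster (zdGraph 2) (spinSites (-1) ω ∩ halfPlane 0) ![a + 1, 0]).Infinite :=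
      infinite_minusCluster_succ_of_isMaxAxis hDinf haD hmax
    refine ⟨z, z', hzz', ?_, ?_⟩
    · show (siteCluster zdStarGraph (spinSites 1 ω' ∩ halfPlane ((0 : ℕ) : ℤ)) z).Infinite
      rw [Nat.cast_zero, ← siteCluster_eq_of_mem hz ((mem_siteCluster_self_iff _ _ _).2 hz.2.1)]
      exact hinf'
    · show (siteCluster (zdGraph 2) (spinSites (-1) ω ∩ halfPlane ((0 : ℕ) : ℤ)) z').Infinite
      rw [Nat.cast_zero, ← siteCluster_eq_of_mem hz' ((mem_siteCluster_self_iff _ _ _).2 hz'.2.1)]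
      exact hCinf
  exact h1.trans (measure_mono_ae hincl)

end Zero

/-! ### Level `n`: the vertical shift -/

section Level

/-- The image of `S ∩ {x₂ ≥ n}` under `x ↦ x - n e₂` is `(S - n e₂) ∩ π_up`. [folklore] -/
theorem image_shift_inter_halfPlane (n : ℕ) (S : Set (Site 2)) :
    (fun x : Site 2 => x + Pi.single 1 (-(n : ℤ))) '' (S ∩ halfPlane n) =
      (fun x : Site 2 => x + Pi.single 1 (-(n : ℤ))) '' S ∩ halfPlane 0 := by
  ext z
  simp only [Set.mem_image, Set.mem_inter_iff, halfPlane, Set.mem_setOf_eq]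
  constructor
  · rintro ⟨y, ⟨hy, hy1⟩, rfl⟩
    refine ⟨⟨y, hy, rfl⟩, ?_⟩
    have hy1' : (n : ℤ) ≤ y 1 := hy1
    show (0 : ℤ) ≤ (y + Pi.single 1 (-(n : ℤ)) : Site 2) 1
    rw [Pi.add_apply, Pi.single_eq_same]; omega
  · rintro ⟨⟨y, hy, rfl⟩, hz1⟩
    refine ⟨y, ⟨hy, ?_⟩, rfl⟩
    have hz1' : (0 : ℤ) ≤ (y + Pi.single 1 (-(n : ℤ)) : Site 2) 1 := hz1
    rw [Pi.add_apply, Pi.single_eq_same] at hz1'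
    show (n : ℤ) ≤ y 1; omega

/-- Transport of "the cluster is infinite" along the vertical shift, `∗` version. [folklore] -/
theorem infinite_starCluster_configShift_iff (n : ℕ) (s : ℤˣ) (ω : SpinConfig (Site 2)) (z : Site 2) :
    (siteCluster zdStarGraph (spinSites s (configShift (Pi.single 1 (-(n : ℤ))) ω) ∩ halfPlane 0) (z + Pi.single 1 (-(n : ℤ)))).Infinite ↔
      (siteCluster zdStarGraph (spinSites s ω ∩ halfPlane n) z).Infinite := by
  set φ := starShiftIso (Pi.single 1 (-(n : ℤ))) with hφ
  have hcfg : (configShift (S := ℤˣ) (Pi.single 1 (-(n : ℤ))) ω : SpinConfig (Site 2)) = configRelabel φ.toEquiv ω := rfl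
  have hO : spinSites s (configShift (S := ℤˣ) (Pi.single 1 (-(n : ℤ))) ω) ∩ halfPlane 0 =
      (φ : Site 2 → Site 2) '' (spinSites s ω ∩ halfPlane n) := by
    rw [hcfg, spinSites_configRelabel]
    exact (image_shift_inter_halfPlane n (spinSites s ω)).symm
  have key : siteCluster zdStarGraph ((φ : Site 2 → Site 2) '' (spinSites s ω ∩ halfPlane n)) (φ z) =
      (φ : Site 2 → Site 2) '' siteCluster zdStarGraph (spinSites s ω ∩ halfPlane n) z := by
    have h := siteCluster_relabel φ (spinSites s ω ∩ halfPlane n) z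
    rwa [SiteConfig.relabel_apply] at h
  rw [hO, show z + Pi.single 1 (-(n : ℤ)) = φ z from rfl, key]
  exact ⟨Set.Infinite.of_image _, fun h => h.image φ.injective.injOn⟩

/-- Transport of "the cluster is infinite" along the vertical shift, lattice version. [folklore] -/
theorem infinite_zdCluster_configShift_iff (n : ℕ) (s : ℤˣ) (ω : SpinConfig (Site 2)) (z : Site 2) :
    (siteCluster (zdGraph 2) (spinSites s (configShift (Pi.single 1 (-(n : ℤ))) ω) ∩ halfPlane 0) (z + Pi.single 1 (-(n : ℤ)))).Infinite ↔
      (siteCluster (zdGraph 2) (spinSites s ω ∩ halfPlane n) z).Infinite := by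
  set φ := zdShiftIso (d := 2) (Pi.single 1 (-(n : ℤ))) with hφ
  have hcfg : (configShift (S := ℤˣ) (Pi.single 1 (-(n : ℤ))) ω : SpinConfig (Site 2)) = configRelabel φ.toEquiv ω := rfl
  have hO : spinSites s (configShift (S := ℤˣ) (Pi.single 1 (-(n : ℤ))) ω) ∩ halfPlane 0 =
      (φ : Site 2 → Site 2) '' (spinSites s ω ∩ halfPlane n) := by
    rw [hcfg, spinSites_configRelabel]
    exact (image_shift_inter_halfPlane n (spinSites s ω)).symm
  have key : siteCluster (zdGraph 2) ((φ : Site 2 → Site 2) '' (spinSites s ω ∩ halfPlane n)) (φ z) =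
      (φ : Site 2 → Site 2) '' siteCluster (zdGraph 2) (spinSites s ω ∩ halfPlane n) z := by
    have h := siteCluster_relabel φ (spinSites s ω ∩ halfPlane n) z
    rwa [SiteConfig.relabel_apply] at h
  rw [hO, show z + Pi.single 1 (-(n : ℤ)) = φ z from rfl, key]
  exact ⟨Set.Infinite.of_image _, fun h => h.image φ.injective.injOn⟩

/-- **The touching event under the vertical shift**: `TouchAt 0` for the shifted pair is
`TouchAt n` for the pair. [folklore] -/
theorem touchAt_configShift_iff (n : ℕ) (ω ω' : SpinConfig (Site 2)) :
    TouchAt 0 (configShift (Pi.single 1 (-(n : ℤ))) ω, configShift (Pi.single 1 (-(n : ℤ))) ω') ↔ TouchAt n (ω, ω') := by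
  set v : Site 2 := Pi.single 1 (-(n : ℤ)) with hv
  have hadj : ∀ a b : Site 2, (zdGraph 2).Adj (a + v) (b + v) ↔ (zdGraph 2).Adj a b := fun a b =>
    (zdShiftIso (d := 2) v).map_rel_iff'
  constructor
  · rintro ⟨z, z', hzz', hz, hz'⟩
    refine ⟨z - v, z' - v, ?_, ?_, ?_⟩
    · rcases hzz' with rfl | h
      · exact Or.inl rfl
      · right; rw [← hadj, sub_add_cancel, sub_add_cancel]; exact h
    · rw [← infinite_starCluster_configShift_iff n 1 ω' (z - v), sub_add_cancel]
      simpa only [Nat.cast_zero] using hz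
    · rw [← infinite_zdCluster_configShift_iff n (-1) ω (z' - v), sub_add_cancel]
      simpa only [Nat.cast_zero] using hz'
  · rintro ⟨z, z', hzz', hz, hz'⟩
    refine ⟨z + v, z' + v, ?_, ?_, ?_⟩
    · rcases hzz' with rfl | h
      · exact Or.inl rfl
      · exact Or.inr ((hadj z z').2 h)
    · have := (infinite_starCluster_configShift_iff n 1 ω' z).2 hz
      simpa only [Nat.cast_zero] using this
    · have := (infinite_zdCluster_configShift_iff n (-1) ω z').2 hz'
      simpa only [Nat.cast_zero] using this

/-- **The layers touch above height `n` with probability `≥ c₀`** (`+`face on the left at level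
`n`): the level-`0` bound for the vertically shifted measure `μ ∘ T⁻¹`, `(T ω)(x) = ω(x + n e₂)`,
transported back. [cite: GeorgiiHiguchi2000, Lemma 5.4 and Lemma 5.5 (proof, Case 3)] -/
theorem le_measure_touchAt_of_level (hβc : criticalBeta 2 < β) (hμ : μ ∈ isingGibbsMeasures 2 β 0) (s : ℤˣ) (n : ℕ)
    (hL : ∀ᵐ ω ∂(μ.map (configShift (Pi.single 1 (-(n : ℤ))))), ∃ x, ∀ n : ℕ, ∃ k : ℤ, k < -(n : ℤ) ∧
      (![k, 0] : Site 2) ∈ siteCluster zdStarGraph (spinSites 1 ω ∩ halfPlane 0) x)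
    (hC : ∀ᵐ ω ∂(μ.map (configShift (Pi.single 1 (-(n : ℤ))))),
      ∃ y, (siteCluster (zdGraph 2) (spinSites (-1) ω ∩ halfPlane 0) y).Infinite) :
    (1 - (1 + ENNReal.ofReal (Real.exp (-(8 * |β|)) / 2))⁻¹) / 2 ≤
      (μ.prod (μ.map (configShift (Pi.single 0 (s : ℤ))))) {p | TouchAt n p} := by
  have hμG : IsGibbsMeasure (isingSpecification (zdGraph 2) β 0) μ := hμ
  haveI := hμG.isProbabilityMeasure
  set v : Site 2 := Pi.single 1 (-(n : ℤ)) with hv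
  have hT : Measurable (configShift (S := ℤˣ) v : SpinConfig (Site 2) → SpinConfig (Site 2)) := (configShift v).measurable
  have hμv : μ.map (configShift v) ∈ isingGibbsMeasures 2 β 0 := mem_isingGibbsMeasures_map_configShift hμ _
  have h := le_measure_touchAt_zero hβc hμv s hL hC
  rw [prod_map_configShift_comm μ (Pi.single 0 (s : ℤ)) v, Measure.map_apply (hT.prodMap hT) (measurableSet_touchAt 0)] at h
  have hpre : Prod.map (configShift (S := ℤˣ) v) (configShift (S := ℤˣ) v) ⁻¹'
      {p : SpinConfig (Site 2) × SpinConfig (Site 2) | TouchAt 0 p} = {p | TouchAt n p} := by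
    ext p
    exact touchAt_configShift_iff n p.1 p.2
  rwa [hpre] at h

end Level

/-! ### The `+`face on the right -/

section Right

/-- The reflection `x₁ ↦ -x₁` as an automorphism of the `∗`-graph. [folklore] -/
def starReflectZeroIso : zdStarGraph ≃g zdStarGraph where
  toEquiv := (reflectCoord (d := 2) 0).toEquiv
  map_rel_iff' := by
    intro a b
    constructor
    · intro h
      have h' := (starReflectHom 0).map_rel h
      rw [starReflectHom_apply, starReflectHom_apply] at h'
      have ea : reflectCoord 0 ((reflectCoord (d := 2) 0).toEquiv a) = a := reflectCoord_reflectCoord 0 a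
      have eb : reflectCoord 0 ((reflectCoord (d := 2) 0).toEquiv b) = b := reflectCoord_reflectCoord 0 b
      rw [ea, eb] at h'
      exact h'
    · intro h
      exact (starReflectHom 0).map_rel h

/-- `starReflectZeroIso` acts by `reflectCoord 0`. [folklore] -/
@[simp] theorem starReflectZeroIso_apply (z : Site 2) : starReflectZeroIso z = reflectCoord 0 z := rfl

/-- **The touching event is invariant under the reflection `x₁ ↦ -x₁` of both layers.** [folklore] -/
theorem touchAt_reflectZero_iff (n : ℕ) (ω ω' : SpinConfig (Site 2)) :
    TouchAt n (configRelabel (reflectCoord (d := 2) 0).toEquiv ω, configRelabel (reflectCoord (d := 2) 0).toEquiv ω') ↔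
      TouchAt n (ω, ω') := by
  -- transport through the isomorphisms, at the level of general half-planes
  have hgen : ∀ {G : SimpleGraph (Site 2)} (φ : G ≃g G), (∀ z : Site 2, (φ z) 1 = z 1) → (∀ z, φ (φ z) = z) →
      ∀ (s : ℤˣ) (σ : SpinConfig (Site 2)) (z : Site 2),
        (siteCluster G (spinSites s (configRelabel φ.toEquiv σ) ∩ halfPlane n) (φ z)).Infinite ↔
          (siteCluster G (spinSites s σ ∩ halfPlane n) z).Infinite := by
    intro G φ hφ hφφ s σ z
    have himg : (φ : Site 2 → Site 2) '' (spinSites s σ ∩ halfPlane n) = (φ : Site 2 → Site 2) '' spinSites s σ ∩ halfPlane n := by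
      ext w
      simp only [Set.mem_image, Set.mem_inter_iff, halfPlane, Set.mem_setOf_eq]
      constructor
      · rintro ⟨y, ⟨hy, hy1⟩, rfl⟩; exact ⟨⟨y, hy, rfl⟩, by rw [hφ]; exact hy1⟩
      · rintro ⟨⟨y, hy, rfl⟩, hz1⟩; exact ⟨y, ⟨hy, by rw [hφ] at hz1; exact hz1⟩, rfl⟩
    have hO : spinSites s (configRelabel φ.toEquiv σ) ∩ halfPlane n = (φ : Site 2 → Site 2) '' (spinSites s σ ∩ halfPlane n) := by
      rw [spinSites_configRelabel, himg]; rfl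
    have key : siteCluster G ((φ : Site 2 → Site 2) '' (spinSites s σ ∩ halfPlane n)) (φ z) =
        (φ : Site 2 → Site 2) '' siteCluster G (spinSites s σ ∩ halfPlane n) z := by
      have h := siteCluster_relabel φ (spinSites s σ ∩ halfPlane n) z
      rwa [SiteConfig.relabel_apply] at h
    rw [hO, key]
    exact ⟨Set.Infinite.of_image _, fun h => h.image φ.injective.injOn⟩
  have hS := hgen starReflectZeroIso (fun z => (reflectCoord_zero_apply z).2) (fun z => reflectCoord_reflectCoord 0 z)
  have hZ := hgen (reflectCoord (d := 2) 0) (fun z => (reflectCoord_zero_apply z).2) (fun z => reflectCoord_reflectCoord 0 z)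
  have hadj : ∀ a b : Site 2, (zdGraph 2).Adj (reflectCoord 0 a) (reflectCoord 0 b) ↔ (zdGraph 2).Adj a b := fun a b =>
    (reflectCoord (d := 2) 0).map_rel_iff'
  constructor
  · rintro ⟨z, z', hzz', hz, hz'⟩
    refine ⟨reflectCoord 0 z, reflectCoord 0 z', ?_, ?_, ?_⟩
    · rcases hzz' with rfl | h
      · exact Or.inl rfl
      · right; rwa [← hadj, reflectCoord_reflectCoord, reflectCoord_reflectCoord]
    · rw [← hS 1 ω' (reflectCoord 0 z), starReflectZeroIso_apply, reflectCoord_reflectCoord]; exact hz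
    · rw [← hZ (-1) ω (reflectCoord 0 z')]
      rw [show (reflectCoord (d := 2) 0) (reflectCoord 0 z') = z' from reflectCoord_reflectCoord 0 z']; exact hz'
  · rintro ⟨z, z', hzz', hz, hz'⟩
    refine ⟨reflectCoord 0 z, reflectCoord 0 z', ?_, (hS 1 ω' z).2 hz, (hZ (-1) ω z').2 hz'⟩
    rcases hzz' with rfl | h
    · exact Or.inl rfl
    · exact Or.inr ((hadj z z').2 h)

/-- **The layers touch with probability `≥ c₀`** (level `0`, `+`face on the right), by the
reflection `x₁ ↦ -x₁` of both layers ("the alternative case is analogous"). [cite: GeorgiiHiguchi2000, Lemma 5.4 (proof: "the alternative case is analogous")] -/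
theorem le_measure_touchAt_zero_right (hβc : criticalBeta 2 < β) (hμ : μ ∈ isingGibbsMeasures 2 β 0) (s : ℤˣ)
    (hR : ∀ᵐ ω ∂μ, ∃ x, ∀ n : ℕ, ∃ k : ℤ, (n : ℤ) < k ∧
      (![k, 0] : Site 2) ∈ siteCluster zdStarGraph (spinSites 1 ω ∩ halfPlane 0) x)
    (hC : ∀ᵐ ω ∂μ, ∃ y, (siteCluster (zdGraph 2) (spinSites (-1) ω ∩ halfPlane 0) y).Infinite) :
    (1 - (1 + ENNReal.ofReal (Real.exp (-(8 * |β|)) / 2))⁻¹) / 2 ≤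
      (μ.prod (μ.map (configShift (Pi.single 0 (s : ℤ))))) {p | TouchAt 0 p} := by
  have hμG : IsGibbsMeasure (isingSpecification (zdGraph 2) β 0) μ := hμ
  haveI := hμG.isProbabilityMeasure
  set ρ : SpinConfig (Site 2) → SpinConfig (Site 2) := ⇑(configRelabel (reflectCoord (d := 2) 0).toEquiv) with hρ
  have hρm : Measurable ρ := (configRelabel _).measurable
  set μR : Measure (SpinConfig (Site 2)) := μ.map ρ with hμR
  have hμRG : μR ∈ isingGibbsMeasures 2 β 0 := IsGibbsMeasure.map_configRelabel _ (reflectCoord 0) hμG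
  have hL' : ∀ᵐ ω ∂μR, ∃ x, ∀ n : ℕ, ∃ k : ℤ, k < -(n : ℤ) ∧
      (![k, 0] : Site 2) ∈ siteCluster zdStarGraph (spinSites 1 ω ∩ halfPlane 0) x := by
    rw [hμR, ae_map_iff hρm.aemeasurable (measurableSet_axisUnboundedBelow_config (G := zdStarGraph) 1 (halfPlane 0))]
    filter_upwards [hR] with ω ⟨x₀, hx₀⟩
    refine ⟨reflectCoord 0 x₀, fun n => ?_⟩
    obtain ⟨k, hk, hmem⟩ := hx₀ n
    refine ⟨-k, by omega, ?_⟩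
    rw [mem_siteCluster_reflectZero_iff, neg_neg, reflectCoord_reflectCoord]
    exact hmem
  have hC' : ∀ᵐ ω ∂μR, ∃ y, (siteCluster (zdGraph 2) (spinSites (-1) ω ∩ halfPlane 0) y).Infinite := by
    rw [hμR, ae_map_iff hρm.aemeasurable (MeasurableSet.of_tailEvents
      (measurableSet_tailEvents_existsInfClusterIn (G := zdGraph 2) (-1) (halfPlane 0)))]
    filter_upwards [hC] with ω ⟨y₀, hy₀⟩
    refine ⟨reflectCoord 0 y₀, ?_⟩
    exact (infinite_siteCluster_configRelabel_iff (reflectCoord (d := 2) 0) (fun z => (reflectCoord_zero_apply z).2) (-1) ω y₀).2 hy₀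
  have h := le_measure_touchAt_zero hβc hμRG (-s) hL' hC'
  have hprod : μR.prod (μR.map (configShift (Pi.single 0 (((-s : ℤˣ) : ℤ))))) =
      (μ.prod (μ.map (configShift (Pi.single 0 (s : ℤ))))).map (Prod.map ρ ρ) := by
    rw [Units.val_neg, hμR, hρ, ← map_prod_reflectZero μ (s : ℤ)]
  rw [hprod, Measure.map_apply (hρm.prodMap hρm) (measurableSet_touchAt 0)] at h
  have hpre : Prod.map ρ ρ ⁻¹' {p : SpinConfig (Site 2) × SpinConfig (Site 2) | TouchAt 0 p} = {p | TouchAt 0 p} := by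
    ext p; exact touchAt_reflectZero_iff 0 p.1 p.2
  rwa [hpre] at h

/-- **The layers touch above height `n` with probability `≥ c₀`** (`+`face on the right at level
`n`). [cite: GeorgiiHiguchi2000, Lemma 5.4 and Lemma 5.5 (proof, Case 3)] -/
theorem le_measure_touchAt_of_level_right (hβc : criticalBeta 2 < β) (hμ : μ ∈ isingGibbsMeasures 2 β 0) (s : ℤˣ) (n : ℕ)
    (hR : ∀ᵐ ω ∂(μ.map (configShift (Pi.single 1 (-(n : ℤ))))), ∃ x, ∀ n : ℕ, ∃ k : ℤ, (n : ℤ) < k ∧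
      (![k, 0] : Site 2) ∈ siteCluster zdStarGraph (spinSites 1 ω ∩ halfPlane 0) x)
    (hC : ∀ᵐ ω ∂(μ.map (configShift (Pi.single 1 (-(n : ℤ))))),
      ∃ y, (siteCluster (zdGraph 2) (spinSites (-1) ω ∩ halfPlane 0) y).Infinite) :
    (1 - (1 + ENNReal.ofReal (Real.exp (-(8 * |β|)) / 2))⁻¹) / 2 ≤
      (μ.prod (μ.map (configShift (Pi.single 0 (s : ℤ))))) {p | TouchAt n p} := by
  have hμG : IsGibbsMeasure (isingSpecification (zdGraph 2) β 0) μ := hμ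
  haveI := hμG.isProbabilityMeasure
  set v : Site 2 := Pi.single 1 (-(n : ℤ)) with hv
  have hT : Measurable (configShift (S := ℤˣ) v : SpinConfig (Site 2) → SpinConfig (Site 2)) := (configShift v).measurable
  have hμv : μ.map (configShift v) ∈ isingGibbsMeasures 2 β 0 := mem_isingGibbsMeasures_map_configShift hμ _
  have h := le_measure_touchAt_zero_right hβc hμv s hR hC
  rw [prod_map_configShift_comm μ (Pi.single 0 (s : ℤ)) v, Measure.map_apply (hT.prodMap hT) (measurableSet_touchAt 0)] at h
  have hpre : Prod.map (configShift (S := ℤˣ) v) (configShift (S := ℤˣ) v) ⁻¹'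
      {p : SpinConfig (Site 2) × SpinConfig (Site 2) | TouchAt 0 p} = {p | TouchAt n p} := by
    ext p
    exact touchAt_configShift_iff n p.1 p.2
  rwa [hpre] at h

end Right

end

end Literature.Probability.LatticeModels
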